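import Literature.Analysis.FluidPDE.PassiveScalarDiagEnergyContinuityGlobal
import HarnessLib

/-!
# `C([0,T]; L²)` solutions of the passive scalar equation with constant diagonal diffusion and
# bounded drift: the homogeneous class and the isotropic classes

Analysis/FluidPDE proof file (everything proved; no definitions, no named facts). Corollaries of
`PassiveScalarDiagEnergyContinuity(Global)` (the forced diagonal class
`Torus.IsWeakScalarTransportDiagForcedOn`) for

* the HOMOGENEOUS diagonal class `Torus.IsWeakScalarTransportDiagOn T a κ u θ₀ θ` — the binder of
  the Hess-Childs–Rowan statements (`UniversalTotalAnomalousDissipator`,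
  `AcceleratingDissipationEnhancement`), which quantify over weak solutions that are
  `Torus.IsL2ContinuousOn (Icc 0 1)`: for such solutions (`κ > 0`, `aᵢ > 0`, `θ₀ ∈ L²`, `u ∈ L^∞`)
  the energy EQUALITY `‖θ(t₂)‖² + 2κ ∫_{t₁}^{t₂} ‖∇θ‖²_a = ‖θ(t₁)‖²` between EVERY pair of times
  (`IsWeakScalarTransportDiagOn.energy_eq_of_isL2ContinuousOn`), hence the solution map is an
  `L²`-CONTRACTION (`….scalarL2Sq_le_of_isL2ContinuousOn`), `θ(0) = θ₀` a.e., and the restart from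
  the own slice at every `σ ∈ [0,T)` (`….translate_of_isL2ContinuousOn`); together with
  `PassiveScalarDiagExistence` (`IsWeakScalarTransportDiagOn.exists_l2Continuous_representative`, the
  `C([0,T];L²)` representative of every weak solution) this is the complete "unique energy solution
  `θ^κ ∈ C([0,T]; L²)`" sentence behind those statements;
* the ISOTROPIC classes (`a ≡ 1`, `Torus.isWeakScalarTransportDiag(Forced)On_one_iff`,
  `Torus.eScalarGradNormSqDiag_one`): `IsWeakScalarTransportForcedOn.exists_l2Continuous_representative`
  / `….energy_eq_of_isL2ContinuousOn` (forced, `∂ₜθ + u·∇θ = κΔθ + s`) and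
  `IsWeakScalarTransportOn.energy_eq_of_isL2ContinuousOn` / `….scalarL2Sq_le_of_isL2ContinuousOn`
  (homogeneous), with the spectral gradient norm `Torus.eScalarGradNormSq`.

Sources: Temam 1979, Ch. III §1 Lemma 1.2 (continuous representative and `d/dt|u|² = 2⟨u',u⟩`);
Bonicatto–Ciampa–Crippa 2024, Thm. 3.3 / (3.4) / Remark 3.4 (energy equality in the corner
`p = ∞`, `q = 2`); DEIJ 2022, (1.2)–(1.3).

## References

* R. Temam, *Navier–Stokes Equations* (North-Holland 1979), Ch. III §1, Lemma 1.2. [`Temam1979`]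
* P. Bonicatto, G. Ciampa, G. Crippa, J. Evol. Equ. 24 (2024), Thm. 3.3, (3.4), Remark 3.4.
  [`BonicattoCiampaCrippa2023`]
* T. D. Drivas, T. M. Elgindi, G. Iyer, I.-J. Jeong, ARMA 243 (2022), (1.1)–(1.3). [`DEIJ2022`]
* E. Hess-Childs, K. Rowan, arXiv:2501.18526 (2025), Thm. 1.1, App. A. [`HessChildsRowan2025a`]
-/

noncomputable section

open _root_.MeasureTheory _root_.Set _root_.Filter _root_.Function _root_.TopologicalSpace
open scoped ENNReal NNReal InnerProductSpace ContDiff Topology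
open Literature.Analysis.FunctionSpaces.Torus Literature.Analysis.FunctionSpaces UnitAddTorus

namespace Literature.Analysis.FluidPDE

variable {d : Type*} [Fintype d] [DecidableEq d]

namespace Torus

omit [DecidableEq d] in
/-- The `L¹_t L²_x` hypothesis holds for the zero source. [folklore] -/
private theorem lintegral_source_zero' (T : ℝ) :
    ∫⁻ t in Ioo 0 T, (∫⁻ x : UnitAddTorus d, ‖(0 : ℝ → UnitAddTorus d → ℝ) t x‖ₑ ^ 2) ^ (1 / 2 : ℝ) < ⊤ := by
  simp

/-! ## The homogeneous diagonal class `IsWeakScalarTransportDiagOn` -/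

namespace IsWeakScalarTransportDiagOn

variable {T κ : ℝ} {a : d → ℝ} {u : ℝ → UnitAddTorus d → EuclideanSpace ℝ d}
  {θ₀ : UnitAddTorus d → ℝ} {θ : ℝ → UnitAddTorus d → ℝ}

/-- **Energy equality between every pair of times for `L²`-continuous weak solutions of
`∂ₜθ + u·∇θ = κ ∑ᵢ aᵢ ∂ᵢ∂ᵢθ`** (`κ > 0`, `aᵢ > 0`, `θ₀ ∈ L²`, `u ∈ L^∞((0,T) × T^d)`, weakly
divergence free for a.e. `t` — part of the class): if `θ ∈ C([0,T]; L²)`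
(`Torus.IsL2ContinuousOn (Icc 0 T) θ`, the binder of the Hess-Childs–Rowan statements), then for
all `0 ≤ t₁ ≤ t₂ ≤ T`, `‖θ(t₂)‖²_{L²} + 2κ ∫_{t₁}^{t₂} ‖∇θ‖²_a = ‖θ(t₁)‖²_{L²}`
(`‖∇θ‖²_a = Torus.eScalarGradNormSqDiag a θ`). Bonicatto–Ciampa–Crippa 2024 Thm. 3.3 / (3.4) /
Remark 3.4, time-pointwise for the continuous representative (Temam 1979, Ch. III §1 Lemma 1.2).
[cite: BonicattoCiampaCrippa2023, Thm. 3.3, (3.4) and Remark 3.4] -/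
theorem energy_eq_of_isL2ContinuousOn (h : IsWeakScalarTransportDiagOn T a κ u θ₀ θ) (hT : 0 < T)
    (hκ : 0 < κ) (ha : ∀ i, 0 < a i) (hθ₀ : MemLp θ₀ 2 volume)
    (hu : MemLp (stLift u) ⊤ (volume.restrict (Ioo 0 T ×ˢ univ))) (hc : IsL2ContinuousOn (Icc 0 T) θ)
    {t₁ t₂ : ℝ} (ht₁ : 0 ≤ t₁) (h12 : t₁ ≤ t₂) (ht₂ : t₂ ≤ T) :
    (∫ x, θ t₂ x ^ 2) + 2 * κ * (∫⁻ τ in Ioo t₁ t₂, Torus.eScalarGradNormSqDiag a (θ τ)).toReal =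
      ∫ x, θ t₁ x ^ 2 := by
  have h' : IsWeakScalarTransportDiagForcedOn T a κ u 0 θ₀ θ := isWeakScalarTransportDiagForcedOn_zero_iff.2 h
  have key := h'.energy_eq_sub_of_isL2ContinuousOn hT hκ ha hθ₀ hu (lintegral_source_zero' (d := d) T) hc
    ht₁ h12 ht₂
  simpa only [Pi.zero_apply, zero_mul, integral_zero, mul_zero, add_zero] using key

/-- **The solution map of `∂ₜθ + u·∇θ = κ ∑ᵢ aᵢ ∂ᵢ∂ᵢθ` is an `L²`-contraction** on
`L²`-continuous weak solutions: `‖θ(t₂)‖²_{L²} ≤ ‖θ(t₁)‖²_{L²}` for `0 ≤ t₁ ≤ t₂ ≤ T`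
(`Torus.scalarL2Sq`; drop the dissipation in `energy_eq_of_isL2ContinuousOn`). [cite: DEIJ2022, (1.2)] -/
theorem scalarL2Sq_le_of_isL2ContinuousOn (h : IsWeakScalarTransportDiagOn T a κ u θ₀ θ) (hT : 0 < T)
    (hκ : 0 < κ) (ha : ∀ i, 0 < a i) (hθ₀ : MemLp θ₀ 2 volume)
    (hu : MemLp (stLift u) ⊤ (volume.restrict (Ioo 0 T ×ˢ univ))) (hc : IsL2ContinuousOn (Icc 0 T) θ)
    {t₁ t₂ : ℝ} (ht₁ : 0 ≤ t₁) (h12 : t₁ ≤ t₂) (ht₂ : t₂ ≤ T) :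
    Torus.scalarL2Sq (θ t₂) ≤ Torus.scalarL2Sq (θ t₁) := by
  have key := h.energy_eq_of_isL2ContinuousOn hT hκ ha hθ₀ hu hc ht₁ h12 ht₂
  have hnn : 0 ≤ 2 * κ * (∫⁻ τ in Ioo t₁ t₂, Torus.eScalarGradNormSqDiag a (θ τ)).toReal := by positivity
  simp only [Torus.scalarL2Sq]
  linarith

/-- **The solution map does not increase the norm of the datum**: `‖θ(t)‖²_{L²} ≤ ‖θ₀‖²_{L²}` for
every `t ∈ [0,T]` and every `L²`-continuous weak solution. [cite: DEIJ2022, (1.2)] -/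
theorem scalarL2Sq_le_datum_of_isL2ContinuousOn (h : IsWeakScalarTransportDiagOn T a κ u θ₀ θ) (hT : 0 < T)
    (hκ : 0 < κ) (ha : ∀ i, 0 < a i) (hθ₀ : MemLp θ₀ 2 volume)
    (hu : MemLp (stLift u) ⊤ (volume.restrict (Ioo 0 T ×ˢ univ))) (hc : IsL2ContinuousOn (Icc 0 T) θ)
    {t : ℝ} (ht : t ∈ Icc 0 T) :
    Torus.scalarL2Sq (θ t) ≤ Torus.scalarL2Sq θ₀ := by
  have h' : IsWeakScalarTransportDiagForcedOn T a κ u 0 θ₀ θ := isWeakScalarTransportDiagForcedOn_zero_iff.2 h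
  have key := h'.energy_eq_of_isL2ContinuousOn hT hκ ha hθ₀ hu (lintegral_source_zero' (d := d) T) hc t ht
  simp only [Pi.zero_apply, zero_mul, integral_zero, mul_zero, add_zero] at key
  have hnn : 0 ≤ 2 * κ * (∫⁻ τ in Ioo 0 t, Torus.eScalarGradNormSqDiag a (θ τ)).toReal := by positivity
  simp only [Torus.scalarL2Sq]
  linarith

/-- **An `L²`-continuous weak solution takes the datum at `t = 0`**: `θ(0) = θ₀` a.e.
[cite: Temam1979, Ch. III §1 Lemma 1.2] -/
theorem zero_ae_eq_of_isL2ContinuousOn (h : IsWeakScalarTransportDiagOn T a κ u θ₀ θ) (hT : 0 < T)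
    (hθ₀ : MemLp θ₀ 2 volume) (hc : IsL2ContinuousOn (Icc 0 T) θ) : θ 0 =ᵐ[volume] θ₀ :=
  (isWeakScalarTransportDiagForcedOn_zero_iff.2 h).zero_ae_eq_of_isL2ContinuousOn hT hθ₀ hc

/-- **An `L²`-continuous weak solution restarts from its own slice at every `σ ∈ [0,T)`**:
`t ↦ θ(σ + t)` is a weak solution on `T^d × [0, T-σ)` with drift `u(σ + ·)` and datum `θ(σ)` (the
semigroup property of the solution map). [cite: DiPernaLions1989, §II.1 (12)–(14)] -/
theorem translate_of_isL2ContinuousOn (h : IsWeakScalarTransportDiagOn T a κ u θ₀ θ)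
    (hc : IsL2ContinuousOn (Icc 0 T) θ) {σ : ℝ} (hσ : 0 ≤ σ) (hσT : σ < T) :
    IsWeakScalarTransportDiagOn (T - σ) a κ (fun t => u (σ + t)) (θ σ) (fun t => θ (σ + t)) := by
  have key := (isWeakScalarTransportDiagForcedOn_zero_iff.2 h).translate_of_isL2ContinuousOn hc hσ hσT
  exact isWeakScalarTransportDiagForcedOn_zero_iff.1 key

end IsWeakScalarTransportDiagOn

/-! ## The isotropic classes (`a ≡ 1`) -/

namespace IsWeakScalarTransportForcedOn

variable {T κ : ℝ} {u : ℝ → UnitAddTorus d → EuclideanSpace ℝ d} {s : ℝ → UnitAddTorus d → ℝ}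
  {θ₀ : UnitAddTorus d → ℝ} {θ : ℝ → UnitAddTorus d → ℝ}

/-- **Energy equality between every pair of times for `L²`-continuous weak solutions of the
forced isotropic equation `∂ₜθ + u·∇θ = κΔθ + s`** (`κ > 0`, `θ₀ ∈ L²`, `u ∈ L^∞`,
`∫₀ᵀ ‖s‖_{L²} < ∞`): for `0 ≤ t₁ ≤ t₂ ≤ T`,
`‖θ(t₂)‖²_{L²} + 2κ ∫_{t₁}^{t₂} ‖∇θ‖² = ‖θ(t₁)‖²_{L²} + 2 ∫_{t₁}^{t₂} ∫ s θ` with the spectral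
gradient norm `Torus.eScalarGradNormSq` (Bonicatto–Ciampa–Crippa 2024, Thm. 3.3 / (3.4) / Rem. 3.4
with a source; DEIJ 2022, (1.2)–(1.3)). [cite: BonicattoCiampaCrippa2023, Thm. 3.3, (3.4) and Remark 3.4] -/
theorem energy_eq_of_isL2ContinuousOn (h : IsWeakScalarTransportForcedOn T κ u s θ₀ θ) (hT : 0 < T)
    (hκ : 0 < κ) (hθ₀ : MemLp θ₀ 2 volume) (hu : MemLp (stLift u) ⊤ (volume.restrict (Ioo 0 T ×ˢ univ)))
    (hs : ∫⁻ t in Ioo 0 T, (∫⁻ x, ‖s t x‖ₑ ^ 2) ^ (1 / 2 : ℝ) < ⊤) (hc : IsL2ContinuousOn (Icc 0 T) θ)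
    {t₁ t₂ : ℝ} (ht₁ : 0 ≤ t₁) (h12 : t₁ ≤ t₂) (ht₂ : t₂ ≤ T) :
    (∫ x, θ t₂ x ^ 2) + 2 * κ * (∫⁻ τ in Ioo t₁ t₂, Torus.eScalarGradNormSq (θ τ)).toReal =
      (∫ x, θ t₁ x ^ 2) + 2 * ∫ τ in Ioo t₁ t₂, ∫ x, s τ x * θ τ x := by
  have h' : IsWeakScalarTransportDiagForcedOn T (fun _ : d => (1 : ℝ)) κ u s θ₀ θ :=
    isWeakScalarTransportDiagForcedOn_one_iff.2 h
  simpa only [Torus.eScalarGradNormSqDiag_one] using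
    h'.energy_eq_sub_of_isL2ContinuousOn hT hκ (fun _ => one_pos) hθ₀ hu hs hc ht₁ h12 ht₂

/-- **Every weak solution of the forced isotropic equation with bounded drift is a.e. a
`C([0,T]; L²)` solution with the energy equality between every pair of times** (the case `a ≡ 1`
of `IsWeakScalarTransportDiagForcedOn.exists_l2Continuous_representative`; Temam 1979, Ch. III §1
Lemma 1.2 for this class). [cite: Temam1979, Ch. III §1 Lemma 1.2] -/
theorem exists_l2Continuous_representative [Nonempty d] (h : IsWeakScalarTransportForcedOn T κ u s θ₀ θ)
    (hT : 0 < T) (hκ : 0 < κ) (hθ₀ : MemLp θ₀ 2 volume)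
    (hu : MemLp (stLift u) ⊤ (volume.restrict (Ioo 0 T ×ˢ univ)))
    (hs : ∫⁻ t in Ioo 0 T, (∫⁻ x, ‖s t x‖ₑ ^ 2) ^ (1 / 2 : ℝ) < ⊤) :
    ∃ w : ℝ → UnitAddTorus d → ℝ,
      IsWeakScalarTransportForcedOn T κ u s θ₀ w ∧
      IsL2ContinuousOn (Icc 0 T) w ∧ w 0 = θ₀ ∧
      (∀ᵐ t ∂(volume.restrict (Ioo 0 T)), w t =ᵐ[volume] θ t) ∧
      ∀ ⦃t₁ t₂ : ℝ⦄, 0 ≤ t₁ → t₁ ≤ t₂ → t₂ ≤ T →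
        (∫ x, w t₂ x ^ 2) + 2 * κ * (∫⁻ τ in Ioo t₁ t₂, Torus.eScalarGradNormSq (w τ)).toReal =
          (∫ x, w t₁ x ^ 2) + 2 * ∫ τ in Ioo t₁ t₂, ∫ x, s τ x * w τ x := by
  have h' : IsWeakScalarTransportDiagForcedOn T (fun _ : d => (1 : ℝ)) κ u s θ₀ θ :=
    isWeakScalarTransportDiagForcedOn_one_iff.2 h
  obtain ⟨w, hw, hwc, hw0, hwae, hE⟩ := h'.exists_l2Continuous_representative hT hκ (fun _ => one_pos) hθ₀ hu hs
  refine ⟨w, isWeakScalarTransportDiagForcedOn_one_iff.1 hw, hwc, hw0, hwae, fun t₁ t₂ ht₁ h12 ht₂ => ?_⟩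
  simpa only [Torus.eScalarGradNormSqDiag_one] using hE ht₁ h12 ht₂

end IsWeakScalarTransportForcedOn

namespace IsWeakScalarTransportOn

variable {T κ : ℝ} {u : ℝ → UnitAddTorus d → EuclideanSpace ℝ d}
  {θ₀ : UnitAddTorus d → ℝ} {θ : ℝ → UnitAddTorus d → ℝ}

/-- **Energy equality between every pair of times for `L²`-continuous weak solutions of
`∂ₜθ + u·∇θ = κΔθ`** (`κ > 0`, `θ₀ ∈ L²`, `u ∈ L^∞`): for `0 ≤ t₁ ≤ t₂ ≤ T`,
`‖θ(t₂)‖²_{L²} + 2κ ∫_{t₁}^{t₂} ‖∇θ‖² = ‖θ(t₁)‖²_{L²}` with `Torus.eScalarGradNormSq` — the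
time-pointwise EQUALITY form of `Torus.IsWeakScalarTransportOn.lintegral_sq_add_le_holds`
(Bonicatto–Ciampa–Crippa 2024 Thm. 3.3 / (3.4) / Remark 3.4; DEIJ 2022 (1.2)).
[cite: BonicattoCiampaCrippa2023, Thm. 3.3, (3.4) and Remark 3.4] -/
theorem energy_eq_of_isL2ContinuousOn (h : IsWeakScalarTransportOn T κ u θ₀ θ) (hT : 0 < T)
    (hκ : 0 < κ) (hθ₀ : MemLp θ₀ 2 volume) (hu : MemLp (stLift u) ⊤ (volume.restrict (Ioo 0 T ×ˢ univ)))
    (hc : IsL2ContinuousOn (Icc 0 T) θ) {t₁ t₂ : ℝ} (ht₁ : 0 ≤ t₁) (h12 : t₁ ≤ t₂) (ht₂ : t₂ ≤ T) :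
    (∫ x, θ t₂ x ^ 2) + 2 * κ * (∫⁻ τ in Ioo t₁ t₂, Torus.eScalarGradNormSq (θ τ)).toReal =
      ∫ x, θ t₁ x ^ 2 := by
  have h' : IsWeakScalarTransportDiagOn T (fun _ : d => (1 : ℝ)) κ u θ₀ θ := isWeakScalarTransportDiagOn_one_iff.2 h
  simpa only [Torus.eScalarGradNormSqDiag_one] using
    h'.energy_eq_of_isL2ContinuousOn hT hκ (fun _ => one_pos) hθ₀ hu hc ht₁ h12 ht₂

/-- **The solution map of `∂ₜθ + u·∇θ = κΔθ` is an `L²`-contraction** on `L²`-continuous weak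
solutions: `‖θ(t₂)‖²_{L²} ≤ ‖θ(t₁)‖²_{L²}` for `0 ≤ t₁ ≤ t₂ ≤ T`. [cite: DEIJ2022, (1.2)] -/
theorem scalarL2Sq_le_of_isL2ContinuousOn (h : IsWeakScalarTransportOn T κ u θ₀ θ) (hT : 0 < T)
    (hκ : 0 < κ) (hθ₀ : MemLp θ₀ 2 volume) (hu : MemLp (stLift u) ⊤ (volume.restrict (Ioo 0 T ×ˢ univ)))
    (hc : IsL2ContinuousOn (Icc 0 T) θ) {t₁ t₂ : ℝ} (ht₁ : 0 ≤ t₁) (h12 : t₁ ≤ t₂) (ht₂ : t₂ ≤ T) :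
    Torus.scalarL2Sq (θ t₂) ≤ Torus.scalarL2Sq (θ t₁) := by
  have h' : IsWeakScalarTransportDiagOn T (fun _ : d => (1 : ℝ)) κ u θ₀ θ := isWeakScalarTransportDiagOn_one_iff.2 h
  exact h'.scalarL2Sq_le_of_isL2ContinuousOn hT hκ (fun _ => one_pos) hθ₀ hu hc ht₁ h12 ht₂

/-- **An `L²`-continuous weak solution of `∂ₜθ + u·∇θ = κΔθ` takes the datum at `t = 0`**:
`θ(0) = θ₀` a.e. [cite: Temam1979, Ch. III §1 Lemma 1.2] -/
theorem zero_ae_eq_of_isL2ContinuousOn (h : IsWeakScalarTransportOn T κ u θ₀ θ) (hT : 0 < T)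
    (hθ₀ : MemLp θ₀ 2 volume) (hc : IsL2ContinuousOn (Icc 0 T) θ) : θ 0 =ᵐ[volume] θ₀ :=
  (isWeakScalarTransportDiagOn_one_iff.2 h).zero_ae_eq_of_isL2ContinuousOn hT hθ₀ hc

end IsWeakScalarTransportOn

end Torus

end Literature.Analysis.FluidPDE

end
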